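import Summits.HodgeConjecture.HodgeConjecture.Theorems.NikulinTwinTransportTwinSimilitudeAlgebraicStubWittCompletionAux

/-!
# Route NikulinTwinTransport · crux `TwinSimilitudeAlgebraic` (stmt-HodgeConjecture-13674) —
# stub `stub_wittCompletion` of line `hyperkaehler-nikulin-anchors` (reshape r1)

**The Witt completion of a partial twin map.** Let `S`, `Sg` be projective K3 surfaces with
integral generators `p`, `pg` of `H⁴`, and let `Φ : H²(S(ℂ); ℂ) → H²(Sg(ℂ); ℂ)` be a PARTIAL TWIN
MAP: rational, type-preserving, carrying the transcendental classes `T(S) = NS(S)^⊥` onto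
`T(Sg)` and doubling the cup form on `T(S)` (nothing is asked on `NS(S)`). Then there are divisor
classes `aᵢ ∈ NS(S)`, `bᵢ ∈ NS(Sg)` such that for ANY linear maps `νᵢ` acting as the products of
divisors `x ↦ (x.aᵢ) bᵢ` the map `Φ + Σᵢ νᵢ` is a rational, type-preserving `2`-similitude on all
of `H²(S)` (Huybrechts 2019 §1, "Witt cancellation over `ℚ`"; Varesco 2023 Thm. 2.1 / Rem. 2.2).

Proof (`stub_wittCompletion`): mark both surfaces (`Huybrechts_K3_marking_exists`); the marking
generators `p₀ = n p`, `p₀' = m pg` have the same sign `n = m = ±1` (`marking_signs_eq`); read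
`Φ` as a `ℚ`-linear `F` of `Λ_ℚ` (`markingConj_intCast`); with `N_ℚ, N'_ℚ ≤ Λ_ℚ` the rational
Néron–Severi points (`exists_nsRat`, non-degenerate by Hodge index) `F` maps `N_ℚ` into `N'_ℚ`
(Lefschetz `(1,1)`), `T_ℚ = N_ℚ^⊥` into `T'_ℚ`, doubles the form on `T_ℚ`, and
`T'_ℚ ∩ F(T_ℚ)^⊥ = 0` (from `T(Sg) ⊆ Φ(T(S))` and the doubling); the field-level
`exists_similitude_completion` (Witt's extension theorem, PROVED in the tree) then gives
`aᵢ ∈ N_ℚ`, `bᵢ ∈ N'_ℚ` with `F + Σᵢ (·.aᵢ) bᵢ` a `2`-similitude `Ψ` of `Λ_ℚ`; back through the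
markings `Φ + Σᵢ νᵢ` restricts to `Ψ` on the rational classes, whence rationality and (both sides
being bilinear) the `2`-similitude identity, while the Hodge types are preserved because every `νᵢ`
kills the `(2,0)`- and `(0,2)`-lines and takes values in `NS(Sg) ⊆ H^{1,1}`.

Hypotheses (all in the registered signature): `Huybrechts_K3_marking_exists`, Hodge index for K3
surfaces (`hodgeIndex_surface`), and the route items `LefschetzOneOneK3` (13678),
`AlgebraicClassesOneOneK3` (15041). Prover seat prover-line-stmt-HodgeConjecture-13674-0.
-/

noncomputable section

set_option linter.dupNamespace false

open CategoryTheory MonoidalCategory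
open scoped Manifold Matrix
open Literature.AlgebraicGeometry.Motives Literature.AlgebraicGeometry.HodgeTheory
open Literature.AlgebraicGeometry.Surfaces Literature.Geometry.Kaehler
open Literature.AlgebraicTopology.SingularHomology
open Summit.HodgeConjecture.HodgeConjecture.Theses.NikulinTwinTransport

namespace Summit.HodgeConjecture.HodgeConjecture.Theorems.NikulinTwinTransport

/-! ## Local notations — VERBATIM those of the registered skeleton
`Cruxes/TwinSimilitudeAlgebraic/Lines/hyperkaehler_nikulin_anchors.lean` -/

/-- `Gen[S, p]`: `p` is an integral generator of `H⁴(S(ℂ); ℂ)` (the generator clause of X). Local notation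
only. -/
local notation3 (prettyPrint := false) "Gen[" S ", " p "]" =>
  (IsIntegralClass p ∧ ∀ q : complexBetti S (2 * 2), IsIntegralClass q → ∃ n : ℤ, q = n • p)

/-- `Perp[S ; x]`: `x ∈ H²(S(ℂ); ℂ)` is TRANSCENDENTAL — cup-orthogonal to every divisor class
`d ∈ NS(S) ⊗ ℂ = algebraicClasses S 1 = N¹H²` (for a projective K3 surface: `x ∈ T(S)_ℚ ⊗ ℂ`), spelled
exactly as in the route items (`TwinTransportRMPicardTwo`). Local notation only.
[cite: Huybrechts2016K3, Ch. 3 Def. 2.5] -/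
local notation3 (prettyPrint := false) "Perp[" S " ; " x "]" =>
  ∀ d ∈ algebraicClasses S 1, cupProduct (rfl : 2 * 1 + 2 * 1 = 2 * 2) x d = 0

/-! ## The sign lemma -/

section Signs

variable {S Sg : SchemeOver ℂ}

/-- **The sign lemma.** Let `S`, `Sg` be projective K3 surfaces with markings `(η, p₀, x₀)`,
`(η', p₀', x₀')` (cup product `= (η·.η·) p₀`, `η⁻¹x₀` spanning the `(2,0)`-classes, `(x̄₀.x₀) > 0`),
let `p`, `pg` be generators of `H⁴` with `p₀ = n p`, `p₀' = m pg`, `n, m = ±1`, and let `Φ` be a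
rational, type-preserving map doubling the cup form on the transcendental classes RELATIVE TO
`p, pg`. Then `n = m`: the `(2,0)`-class `σ = η⁻¹x₀` and its conjugate are transcendental
(`NS ⊆ H^{1,1} ⊥ σ, σ̄`), `Φσ = s σ'` and, `Φ` being real (defined over `ℚ`), `Φσ̄ = s̄ σ̄'`; so
`|s|² m (σ'.σ̄') = 2 n (σ.σ̄)` with `(σ.σ̄), (σ'.σ̄') > 0`, which pins the signs.
[cite: Huybrechts2016K3, Ch. 6 Prop. 1.2] [cite: Buskin2019, §6.2, proof of Thm. 1.1] -/
theorem marking_signs_eq (hS : IsK3Surface S) (hSg : IsK3Surface Sg) (hN : AlgebraicClassesOneOneK3)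
    (η : complexBetti S (2 * 1) ≃ₗ[ℂ] (K3Index → ℂ)) (p₀ p : complexBetti S (2 * 2)) (x₀ : K3Index → ℂ)
    (hηint : ∀ c : complexBetti S (2 * 1), IsIntegralClass c ↔ ∃ v : K3Index → ℤ, η c = fun i => (v i : ℂ))
    (hηcup : ∀ a b : complexBetti S (2 * 1),
      cupProduct (rfl : 2 * 1 + 2 * 1 = 2 * 2) a b = k3Form (η a) (η b) • p₀)
    (h20 : IsOfHodgeType 2 S (2 * 1) 2 0 (η.symm x₀)) (hx₀ : 0 < (k3Form (star x₀) x₀).re)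
    (η' : complexBetti Sg (2 * 1) ≃ₗ[ℂ] (K3Index → ℂ)) (p₀' pg : complexBetti Sg (2 * 2))
    (x₀' : K3Index → ℂ)
    (hη'int : ∀ c : complexBetti Sg (2 * 1), IsIntegralClass c ↔ ∃ v : K3Index → ℤ, η' c = fun i => (v i : ℂ))
    (hη'cup : ∀ a b : complexBetti Sg (2 * 1),
      cupProduct (rfl : 2 * 1 + 2 * 1 = 2 * 2) a b = k3Form (η' a) (η' b) • p₀')
    (h20span' : ∀ τ : complexBetti Sg (2 * 1),
      IsOfHodgeType 2 Sg (2 * 1) 2 0 τ → ∃ t : ℂ, τ = t • η'.symm x₀')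
    (hx₀' : 0 < (k3Form (star x₀') x₀').re) (hpg : pg ≠ 0)
    (n m : ℤ) (hn : p₀ = (n : ℂ) • p) (hm : p₀' = (m : ℂ) • pg)
    (hn1 : n = 1 ∨ n = -1) (hm1 : m = 1 ∨ m = -1)
    (Φ : complexBetti S (2 * 1) →ₗ[ℂ] complexBetti Sg (2 * 1))
    (hΦrat : ∀ x, IsRationalClass x → IsRationalClass (Φ x))
    (hΦtype : ∀ (i j : ℕ) x, IsOfHodgeType 2 S (2 * 1) i j x → IsOfHodgeType 2 Sg (2 * 1) i j (Φ x))
    (hΦsim : ∀ x : complexBetti S (2 * 1),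
      (∀ d ∈ algebraicClasses S 1, cupProduct (rfl : 2 * 1 + 2 * 1 = 2 * 2) x d = 0) →
      ∀ y : complexBetti S (2 * 1),
        (∀ d ∈ algebraicClasses S 1, cupProduct (rfl : 2 * 1 + 2 * 1 = 2 * 2) y d = 0) →
        ∀ a : ℂ, cupProduct (rfl : 2 * 1 + 2 * 1 = 2 * 2) x y = a • p →
          cupProduct (rfl : 2 * 1 + 2 * 1 = 2 * 2) (Φ x) (Φ y) = ((2 : ℂ) * a) • pg) :
    n = m := by
  -- the `(2,0)`-class `σ = η⁻¹ x₀` and its conjugate are transcendental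
  have hσ0 : η.symm x₀ ≠ 0 := fun h0 =>
    ne_zero_of_star_self_re_pos hx₀ (by simpa using congrArg η h0)
  obtain ⟨-, -, h11⟩ := Huybrechts_K3_hodgeTypes_H2_holds S hS (η.symm x₀) h20 hσ0
  have hperpσ : ∀ d ∈ algebraicClasses S 1,
      cupProduct (rfl : 2 * 1 + 2 * 1 = 2 * 2) (η.symm x₀) d = 0 := fun d hd => by
    have h := ((h11 d).1 (hN S hS d hd)).1
    rw [hηcup] at h ⊢
    rwa [k3Form_comm]
  have hperpσ' : ∀ d ∈ algebraicClasses S 1,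
      cupProduct (rfl : 2 * 1 + 2 * 1 = 2 * 2) (conjClass (ComplexPoints S) (2 * 1) (η.symm x₀)) d = 0 :=
    fun d hd => by
    have h := ((h11 d).1 (hN S hS d hd)).2
    rw [hηcup] at h ⊢
    rwa [k3Form_comm]
  -- `σ ∪ σ̄ = n (x₀.x̄₀) p`
  have hσσ : cupProduct (rfl : 2 * 1 + 2 * 1 = 2 * 2) (η.symm x₀)
      (conjClass (ComplexPoints S) (2 * 1) (η.symm x₀)) = ((n : ℂ) * k3Form x₀ (star x₀)) • p := by
    rw [conjClass_marking_symm η hηint, hηcup, LinearEquiv.apply_symm_apply,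
      LinearEquiv.apply_symm_apply, hn, smul_smul, mul_comm (k3Form x₀ (star x₀)) (n : ℂ)]
  have h5 := hΦsim _ hperpσ _ hperpσ' _ hσσ
  -- `Φσ = s σ'` and, by reality of `Φ`, `Φσ̄ = s̄ σ̄'`
  obtain ⟨s, hs⟩ := h20span' _ (hΦtype 2 0 _ h20)
  have hρrat := markingConj_intCast hSg η' hη'int η hηint Φ hΦrat
  have hreal := ratEnd_star (η'.toLinearMap ∘ₗ Φ ∘ₗ η.symm.toLinearMap) hρrat x₀
  simp only [LinearMap.coe_comp, LinearEquiv.coe_coe, Function.comp_apply] at hreal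
  rw [hs, map_smul, LinearEquiv.apply_symm_apply, star_smul] at hreal
  have hΦσ' : Φ (conjClass (ComplexPoints S) (2 * 1) (η.symm x₀)) =
      η'.symm (star s • star x₀') := by
    rw [conjClass_marking_symm η hηint, ← hreal, LinearEquiv.symm_apply_apply]
  rw [hs, hΦσ', hη'cup, map_smul, LinearEquiv.apply_symm_apply, LinearEquiv.apply_symm_apply,
    k3Form_smul_left, k3Form_smul_right, hm, smul_smul] at h5
  have heq : s * (star s * k3Form x₀' (star x₀')) * (m : ℂ) = 2 * ((n : ℂ) * k3Form x₀ (star x₀)) :=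
    smul_left_injective ℂ hpg h5
  -- real parts: `|s|² m (x̄₀'.x₀') = 2 n (x̄₀.x₀)`
  have hss : s * star s = ((Complex.normSq s : ℝ) : ℂ) := by
    rw [Complex.star_def, Complex.mul_conj]
  rw [← mul_assoc, hss, k3Form_comm x₀', k3Form_comm x₀] at heq
  have hre := congrArg Complex.re heq
  simp only [Complex.mul_re, Complex.ofReal_re, Complex.ofReal_im, zero_mul, sub_zero,
    Complex.intCast_re, Complex.intCast_im, mul_zero, Complex.re_ofNat, Complex.im_ofNat] at hre
  have hS0 : 0 ≤ Complex.normSq s := Complex.normSq_nonneg s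
  have hprod : 0 ≤ Complex.normSq s * (k3Form (star x₀') x₀').re := mul_nonneg hS0 hx₀'.le
  rcases hn1 with rfl | rfl <;> rcases hm1 with rfl | rfl
  · rfl
  · exfalso
    simp only [Int.cast_neg, Int.cast_one] at hre
    nlinarith
  · exfalso
    simp only [Int.cast_neg, Int.cast_one] at hre
    nlinarith
  · rfl

end Signs

/-! ## The stub -/

/-- **Stub `stub_wittCompletion` (registered form, line `hyperkaehler-nikulin-anchors` of crux
stmt-HodgeConjecture-13674): the Witt completion of a partial twin map by products of divisors is a
rational, type-preserving `2`-similitude on all of `H²(S)`.** See the module docstring for the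
proof. [cite: Huybrechts2019, §1] [cite: Varesco2023, Thm. 2.1 and Rem. 2.2]
[cite: Iversen1992, Ch. I §2 Thm. 2.4] -/
theorem stub_wittCompletion :
    Huybrechts_K3_marking_exists → (∀ (S : SchemeOver ℂ), IsK3Surface S → hodgeIndex_surface S) →
    LefschetzOneOneK3 → AlgebraicClassesOneOneK3 →
      ∀ (S Sg : SchemeOver ℂ) (hS : IsK3Surface S) (hSg : IsK3Surface Sg)
        (p : complexBetti S (2 * 2)) (pg : complexBetti Sg (2 * 2)), Gen[S, p] → Gen[Sg, pg] →
        ∀ (Φ : complexBetti S (2 * 1) →ₗ[ℂ] complexBetti Sg (2 * 1)),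
          (∀ x, IsRationalClass x → IsRationalClass (Φ x)) →
          (∀ (i j : ℕ) x, IsOfHodgeType 2 S (2 * 1) i j x → IsOfHodgeType 2 Sg (2 * 1) i j (Φ x)) →
          (∀ x, Perp[S ; x] → Perp[Sg ; Φ x]) →
          (∀ y, Perp[Sg ; y] → ∃ x, Perp[S ; x] ∧ Φ x = y) →
          (∀ x, Perp[S ; x] → ∀ y, Perp[S ; y] → ∀ a : ℂ,
            cupProduct (rfl : 2 * 1 + 2 * 1 = 2 * 2) x y = a • p →
              cupProduct (rfl : 2 * 1 + 2 * 1 = 2 * 2) (Φ x) (Φ y) = ((2 : ℂ) * a) • pg) →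
          ∃ (m : ℕ) (a : Fin m → complexBetti S (2 * 1)) (b : Fin m → complexBetti Sg (2 * 1)),
            (∀ i, a i ∈ algebraicClasses S 1) ∧ (∀ i, b i ∈ algebraicClasses Sg 1) ∧
            ∀ (ν : Fin m → (complexBetti S (2 * 1) →ₗ[ℂ] complexBetti Sg (2 * 1))),
              (∀ i (x : complexBetti S (2 * 1)) (t : ℂ),
                cupProduct (rfl : 2 * 1 + 2 * 1 = 2 * 2) x (a i) = t • p → ν i x = t • b i) →
              (∀ x, IsRationalClass x → IsRationalClass ((Φ + ∑ i, ν i) x)) ∧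
              (∀ (i j : ℕ) x, IsOfHodgeType 2 S (2 * 1) i j x →
                IsOfHodgeType 2 Sg (2 * 1) i j ((Φ + ∑ i, ν i) x)) ∧
              (∀ (x y : complexBetti S (2 * 1)) (c : ℂ),
                cupProduct (rfl : 2 * 1 + 2 * 1 = 2 * 2) x y = c • p →
                  cupProduct (rfl : 2 * 1 + 2 * 1 = 2 * 2) ((Φ + ∑ i, ν i) x)
                    ((Φ + ∑ i, ν i) y) = ((2 : ℂ) * c) • pg) := by
  intro hmark hHI hL hN S Sg hS hSg p pg hp hpg Φ hΦrat hΦtype hΦT hΦT' hΦsim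
  classical
  -- markings of `S` and `Sg`
  obtain ⟨η, p₀, x₀, hp₀, ⟨hp₀int, hp₀gen, hηint, hηcup, h20, -⟩, ⟨-, hx₀, -⟩⟩ := hmark S hS
  obtain ⟨η', p₀', x₀', hp₀', ⟨hp₀'int, hp₀'gen, hη'int, hη'cup, -, h20span'⟩, ⟨-, hx₀', -⟩⟩ :=
    hmark Sg hSg
  -- the generators: `p₀ = n • p`, `p₀' = m • pg` with `n, m = ±1`
  obtain ⟨n, hn⟩ := hp.2 p₀ hp₀int
  obtain ⟨n₁, hn₁⟩ := hp₀gen p hp.1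
  obtain ⟨m, hm⟩ := hpg.2 p₀' hp₀'int
  obtain ⟨m₁, hm₁⟩ := hp₀'gen pg hpg.1
  rw [← Int.cast_smul_eq_zsmul ℂ] at hn hn₁ hm hm₁
  have hn1 : n = 1 ∨ n = -1 := by
    refine Int.eq_one_or_neg_one_of_mul_eq_one (v := n₁) ?_
    have h : ((n * n₁ : ℤ) : ℂ) • p₀ = (1 : ℂ) • p₀ := by
      rw [one_smul, Int.cast_mul, ← smul_smul, ← hn₁, ← hn]
    exact_mod_cast smul_left_injective ℂ hp₀ h
  have hm1 : m = 1 ∨ m = -1 := by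
    refine Int.eq_one_or_neg_one_of_mul_eq_one (v := m₁) ?_
    have h : ((m * m₁ : ℤ) : ℂ) • p₀' = (1 : ℂ) • p₀' := by
      rw [one_smul, Int.cast_mul, ← smul_smul, ← hm₁, ← hm]
    exact_mod_cast smul_left_injective ℂ hp₀' h
  have hp0 : p ≠ 0 := by
    rintro rfl
    exact hp₀ (by rw [hn, smul_zero])
  have hpg0 : pg ≠ 0 := by
    rintro rfl
    exact hp₀' (by rw [hm, smul_zero])
  -- the sign lemma: `n = m`
  obtain rfl : n = m := marking_signs_eq hS hSg hN η p₀ p x₀ hηint hηcup h20 hx₀ η' p₀' pg x₀'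
    hη'int hη'cup h20span' hx₀' hpg0 n m hn hm hn1 hm1 Φ hΦrat hΦtype hΦsim
  have hn2 : (n : ℂ) * n = 1 := by rcases hn1 with rfl | rfl <;> norm_num
  -- cup products relative to `p`, `pg`
  have hcupS : ∀ a b : complexBetti S (2 * 1),
      cupProduct (rfl : 2 * 1 + 2 * 1 = 2 * 2) a b = ((n : ℂ) * k3Form (η a) (η b)) • p := fun a b => by
    rw [hηcup, hn, smul_smul, mul_comm (k3Form (η a) (η b)) (n : ℂ)]
  have hcupSg : ∀ a b : complexBetti Sg (2 * 1),
      cupProduct (rfl : 2 * 1 + 2 * 1 = 2 * 2) a b = ((n : ℂ) * k3Form (η' a) (η' b)) • pg := fun a b => by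
    rw [hη'cup, hm, smul_smul, mul_comm (k3Form (η' a) (η' b)) (n : ℂ)]
  have hsmulS : ∀ {c c' : ℂ}, c • p = c' • p → c = c' := fun h => smul_left_injective ℂ hp0 h
  have hsmulSg : ∀ {c c' : ℂ}, c • pg = c' • pg → c = c' := fun h => smul_left_injective ℂ hpg0 h
  -- `Φ` read through the markings: a `ℚ`-linear `F` of `Λ_ℚ`
  obtain ⟨F, hF⟩ := exists_ratEnd_of_forall_intCast (η'.toLinearMap ∘ₗ Φ ∘ₗ η.symm.toLinearMap)
    (markingConj_intCast hSg η' hη'int η hηint Φ hΦrat)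
  have hF' : ∀ u : K3Index → ℚ, η' (Φ (η.symm fun j => (u j : ℂ))) = fun j => (F u j : ℂ) := fun u => by
    simpa only [LinearMap.coe_comp, LinearEquiv.coe_coe, Function.comp_apply] using hF u
  have hFx : ∀ u : K3Index → ℚ, Φ (η.symm fun j => (u j : ℂ)) = η'.symm fun j => (F u j : ℂ) := fun u => by
    rw [← hF' u, LinearEquiv.symm_apply_apply]
  -- the rational Néron–Severi points of `S` and `Sg`
  obtain ⟨NQ, memNQ, hNQ, hTQ, hperpN, -⟩ := exists_nsRat hS (hHI S hS) η hp₀ hηint hηcup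
  obtain ⟨NQ', memNQ', hNQ', hTQ', -, hperpT'⟩ := exists_nsRat hSg (hHI Sg hSg) η' hp₀' hη'int hη'cup
  have hc : IsCompl NQ (k3FormRat.orthogonal NQ) :=
    (LinearMap.BilinForm.restrict_nondegenerate_iff_isCompl_orthogonal k3FormRat_isSymm.isRefl).1 hNQ
  -- (a) `F(N_ℚ) ⊆ N'_ℚ` (Lefschetz `(1,1)` on `Sg`)
  have hFN : ∀ u ∈ NQ, F u ∈ NQ' := fun u hu => by
    rw [memNQ', ← hFx]
    exact map_mem_algebraicClasses_of_hodgeMap hS hSg hL hN Φ hΦrat (hΦtype 1 1) ((memNQ u).1 hu)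
  -- (b) `F(T_ℚ) ⊆ T'_ℚ`
  have hFT : ∀ t ∈ k3FormRat.orthogonal NQ, F t ∈ k3FormRat.orthogonal NQ' := fun t ht => by
    refine hperpT' _ ?_
    rw [← hFx]
    exact hΦT _ (hTQ t ht)
  -- (c) `F` doubles the form on `T_ℚ`
  have hFsim : ∀ u ∈ k3FormRat.orthogonal NQ, ∀ v ∈ k3FormRat.orthogonal NQ,
      k3FormRat (F u) (F v) = 2 * k3FormRat u v := fun u hu v hv => by
    have h1 : cupProduct (rfl : 2 * 1 + 2 * 1 = 2 * 2) (η.symm fun j => (u j : ℂ))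
        (η.symm fun j => (v j : ℂ)) = ((n : ℂ) * (k3FormRat u v : ℂ)) • p := by
      rw [hcupS, LinearEquiv.apply_symm_apply, LinearEquiv.apply_symm_apply, k3Form_ratCast]
    have h2 := hΦsim _ (hTQ u hu) _ (hTQ v hv) _ h1
    rw [hFx, hFx, hcupSg, LinearEquiv.apply_symm_apply, LinearEquiv.apply_symm_apply,
      k3Form_ratCast] at h2
    have h3 := hsmulSg h2
    apply Rat.cast_injective (α := ℂ)
    rw [Rat.cast_mul, Rat.cast_ofNat]
    linear_combination (n : ℂ) * h3 - ((k3FormRat (F u) (F v) : ℂ) - 2 * (k3FormRat u v : ℂ)) * hn2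
  -- (d) `T'_ℚ ∩ F(T_ℚ)^⊥ = 0` (from `T(Sg) ⊆ Φ(T(S))` and the doubling)
  have hkey : ∀ v ∈ k3FormRat.orthogonal NQ',
      (∀ t ∈ k3FormRat.orthogonal NQ, k3FormRat (F t) v = 0) → v = 0 := by
    intro v hv hFv
    obtain ⟨x, hx, hxy⟩ := hΦT' (η'.symm fun j => (v j : ℂ)) (hTQ' v hv)
    -- `η x` is K3-orthogonal to `T_ℚ` and to `N_ℚ`, hence zero
    have hxT : ∀ t ∈ k3FormRat.orthogonal NQ, k3Form (fun j => (t j : ℂ)) (η x) = 0 := fun t ht => by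
      have h1 : cupProduct (rfl : 2 * 1 + 2 * 1 = 2 * 2) (η.symm fun j => (t j : ℂ)) x =
          ((n : ℂ) * k3Form (fun j => (t j : ℂ)) (η x)) • p := by
        rw [hcupS, LinearEquiv.apply_symm_apply]
      have h2 := hΦsim _ (hTQ t ht) _ hx _ h1
      rw [hFx, hxy, hcupSg, LinearEquiv.apply_symm_apply, LinearEquiv.apply_symm_apply,
        k3Form_ratCast, hFv t ht, Rat.cast_zero, mul_zero, zero_smul] at h2
      have h3 : (2 : ℂ) * ((n : ℂ) * k3Form (fun j => (t j : ℂ)) (η x)) = 0 :=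
        hsmulSg (by rw [zero_smul]; exact h2.symm)
      have h4 : (n : ℂ) ≠ 0 := by rcases hn1 with rfl | rfl <;> norm_num
      simpa [h4] using h3
    have hxall : ∀ u : K3Index → ℚ, k3Form (fun j => (u j : ℂ)) (η x) = 0 := fun u => by
      obtain ⟨w, hw, t, ht, rfl⟩ := Submodule.mem_sup.1
        (show u ∈ NQ ⊔ k3FormRat.orthogonal NQ by rw [hc.sup_eq_top]; exact Submodule.mem_top)
      rw [ratCastΛ_add, k3Form_add_left, hperpN x hx w hw, hxT t ht, add_zero]
    have hx0 : η x = 0 := by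
      refine k3FormC_nondegenerate.1 (η x) fun z => ?_
      have hlin : k3FormC (η x) = 0 := by
        refine (Pi.basisFun ℂ K3Index).ext fun j => ?_
        rw [basisFun_eq_ratCastΛ, k3FormC_apply, k3Form_comm, hxall, LinearMap.zero_apply]
      rw [hlin, LinearMap.zero_apply]
    have hx00 : x = 0 := η.injective (by rw [hx0, map_zero])
    have hy0 : η'.symm (fun j => (v j : ℂ)) = 0 := by rw [← hxy, hx00, map_zero]
    have hv0 : (fun j => (v j : ℂ)) = 0 := by simpa using congrArg η' hy0
    exact ratCastΛ_injective (hv0.trans ratCastΛ_zero.symm)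
  -- Witt completion over `ℚ`
  obtain ⟨M, hM⟩ := exists_twoSimilitude_k3FormRat
  obtain ⟨k, a', b', Ψ, ha', hb', hΨ, hsim⟩ := exists_similitude_completion k3FormRat_isSymm
    k3FormRat_nondegenerate (two_ne_zero (α := ℚ)) M hM NQ NQ' hNQ hNQ' F hFN hFT hFsim hkey
  -- the correction classes `aᵢ = n η⁻¹a'ᵢ ∈ NS(S)`, `bᵢ = η'⁻¹b'ᵢ ∈ NS(Sg)`
  refine ⟨k, fun i => (n : ℂ) • η.symm (fun j => (a' i j : ℂ)), fun i => η'.symm (fun j => (b' i j : ℂ)),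
    fun i => Submodule.smul_mem _ _ ((memNQ _).1 (ha' i)), fun i => (memNQ' _).1 (hb' i),
    fun ν hν => ?_⟩
  -- every `νᵢ` IS the product of divisors `x ↦ (ηx.a'ᵢ) bᵢ`
  have hνx : ∀ i x, ν i x = k3Form (η x) (fun j => (a' i j : ℂ)) • η'.symm (fun j => (b' i j : ℂ)) :=
    fun i x => by
    refine hν i x _ ?_
    rw [hcupS, map_smul, LinearEquiv.apply_symm_apply, k3Form_smul_right, ← mul_assoc, hn2, one_mul]
  -- through the markings, `Φ + Σ νᵢ` restricts to `Ψ` on `Λ_ℚ`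
  have hΛ : ∀ u : K3Index → ℚ,
      η' ((Φ + ∑ i, ν i) (η.symm fun j => (u j : ℂ))) = fun j => (Ψ u j : ℂ) := fun u => by
    rw [hΨ u, LinearMap.add_apply, LinearMap.sum_apply, map_add, map_sum, hF', ratCastΛ_add,
      ratCastΛ_sum]
    congr 1
    refine Finset.sum_congr rfl fun i _ => ?_
    rw [hνx, map_smul, LinearEquiv.apply_symm_apply, LinearEquiv.apply_symm_apply, k3Form_ratCast,
      ratCastΛ_smul]
  refine ⟨fun x hx => ?_, ?_, fun x y c hxy => ?_⟩
  · -- rationality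
    obtain ⟨u, hu⟩ := (isRationalClass_iff_of_marking hS η hηint x).1 hx
    have hx' : x = η.symm fun j => (u j : ℂ) := by rw [← hu, LinearEquiv.symm_apply_apply]
    refine (isRationalClass_iff_of_marking hSg η' hη'int _).2 ⟨Ψ u, ?_⟩
    rw [hx', hΛ u]
  · -- Hodge types
    have hσ0 : η.symm x₀ ≠ 0 := fun h0 =>
      ne_zero_of_star_self_re_pos hx₀ (by simpa using congrArg η h0)
    obtain ⟨-, -, h11⟩ := Huybrechts_K3_hodgeTypes_H2_holds S hS (η.symm x₀) h20 hσ0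
    refine isOfHodgeType_add_sum hS hSg h20 hσ0 Φ hΦtype ν (fun i => ?_) (fun i => ?_) fun i x => ?_
    · have h := ((h11 _).1 (hN S hS _ ((memNQ _).1 (ha' i)))).1
      rw [hηcup, LinearEquiv.apply_symm_apply, LinearEquiv.apply_symm_apply, smul_eq_zero,
        or_iff_left hp₀] at h
      rw [hνx, LinearEquiv.apply_symm_apply, k3Form_comm, h, zero_smul]
    · have h := ((h11 _).1 (hN S hS _ ((memNQ _).1 (ha' i)))).2
      rw [conjClass_marking_symm η hηint, hηcup, LinearEquiv.apply_symm_apply,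
        LinearEquiv.apply_symm_apply, smul_eq_zero, or_iff_left hp₀] at h
      rw [conjClass_marking_symm η hηint, hνx, LinearEquiv.apply_symm_apply, k3Form_comm, h, zero_smul]
    · rw [hνx]
      exact (hN Sg hSg _ ((memNQ' _).1 (hb' i))).smul _
  · -- the `2`-similitude identity, complexified
    have hΛ' : ∀ u : K3Index → ℚ,
        (η'.toLinearMap ∘ₗ (Φ + ∑ i, ν i) ∘ₗ η.symm.toLinearMap) (fun j => (u j : ℂ)) =
          fun j => (Ψ u j : ℂ) := fun u => by
      simpa only [LinearMap.coe_comp, LinearEquiv.coe_coe, Function.comp_apply] using hΛ u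
    have h2 := k3Form_of_ratRestriction _ Ψ hΛ' 2 hsim (η x) (η y)
    simp only [LinearMap.coe_comp, LinearEquiv.coe_coe, Function.comp_apply,
      LinearEquiv.symm_apply_apply, Rat.cast_ofNat] at h2
    rw [hcupS] at hxy
    have hc' := hsmulS hxy
    rw [hcupSg, h2, ← hc']
    congr 1
    ring

end Summit.HodgeConjecture.HodgeConjecture.Theorems.NikulinTwinTransport

end
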